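import Summits.ABC.IUTFork.Cor312CapstoneSingleHaarObstruction
import Summits.ABC.IUTFork.Cor312SettingPrVol
import Summits.ABC.IUTFork.Cor312VolumesRealPrArch
import HarnessLib

/-!
# [IUTchIII] Cor. 3.12, TEAM B — the single-Haar «Iff» obstruction at ALL FOUR normalisation
# corners: `situationPrVol`, `situationDHVolArch`, `situationDHVolPrArch`

Record-only file (D-0012) of the abc-iut cell (Cor. 3.12 strategy TEAM B «estimate / log-Kummer» of
HUMAN RULING D-0067 (3), seat abc-iut-c312-11 = B1, gen 6); PROOF-ONLY (0 defs); TAKES NO SIDE.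

`Cor312CapstoneSingleHaarObstruction` (p450504) closed the kit-l. 43 TEAM B residual negatively at
the canonical assembled setting: no carrier family / integral structures / comparison maps satisfy
the abstract capstone's (p413800) single-Haar `hAdm` «Iff» binder over `Thm311.Real.situationDHVol`
once one rational prime carries two distinct places of `F`. The NORMALISATION CAVEAT of
`plan/C312-RESIDUALS.md` (c312-1 g5 finding F-c312-1-g5-1) asks every `settingDHVol`-level TEAM B
statement to be re-pointed to the print-normalised and honest-archimedean corners or to state why it
transfers. This file DOES the re-pointing: the obstruction is SET-LEVEL (it concerns only the
admissibility predicate, never a log-volume number, and only one nonarchimedean place), and the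
prime-side local pieces of all four containers are the SAME real prime packets with the SAME
admissibility `PacketAdm` — `summandPiecesPr` replaces only the weights (c312-1
`padicPresentationPr = { padicPresentationDH with w := Pr }`), the `…Arch` containers replace only
the `∞`-pieces (`localPiecesDHArch`/`localPiecesPrArch` match `.inr` to the same
`padicPresentationDH`/`padicPresentationPr`). Hence, VERBATIM at each corner:

* `Thm311.Real.not_singleHaarAdm_situationPrVol` — print-normalised weights, trivial `∞`;
* `Thm311.Real.not_singleHaarAdm_situationDHVolArch` — Dupuy–Hilado weights, honest `∞`
  (all-complex convention `hc`, w5-d163's fourth-corner apparatus);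
* `Thm311.Real.not_singleHaarAdm_situationDHVolPrArch` — print-normalised at EVERY place (the
  fourth corner `settingPrVolArch` sits over this situation).

Same witness at every corner: label `0` over a prime `pp` with two distinct places `v₁ ≠ v₂` of `F`
(every genuine initial Θ-datum: `F ⊋ ℚ`, [IUTchI] Def. 3.1, has split primes; hypothesis carried
explicitly), the two constant tuples as distinct summands, the normalised integral tensor packet
`(R_I)^∼` and a disjoint additive translate as incomparable admissible factors ([IUTchIII]
Rmk. 3.1.1 (iii) p. 95 l. 28–30 vs measure union-closure). CONSEQUENCE (honest, nothing reopened):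
at EVERY corner of the real model the capstone-granularity interface is the REALISED-container one
(p415747/p417670 and their Pr/Arch re-pointings) — the single-Haar «Iff» reading lives only at
honest single-Haar situations (the `ZMod 4` capstone witness p416604/p416831). Sources read on the
page (kurims `paper:url-4b091feeb646`): [IUTchIII] Rmk. 3.1.1 (ii)(iii) pp. 94–96, Cor. 3.12
pp. 173–174; [IUTchIV] Prop. 1.4 (i) p. 13. [claim: Mochizuki2012, status: disputed]
[cite: DupuyHilado2025, §2.4.5, §3.6, Def. 3.6.1]
NO new definition, NO new `Prop`; no judgement on [IUTchIII] Cor. 3.12; typed ≠ proved.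
-/

noncomputable section

open Set Function NumberField
open scoped Pointwise ENNReal

namespace Summit.ABC

namespace IUTFork

namespace Thm311

namespace Real

open Cor312Vol Literature.IUT.LogThetaLattice Literature.IUT.LogVolume

variable {F : Type} [Field F] [NumberField F] (X : PilotData F) {logv : PadicLogs F}
  (hlog : LogvAnalytic logv) (M : Type) [Field M] [NumberField M]
  (archPk : ∀ (j : (thetaIndex X).Label) (vQ : (thetaIndex X).VQ),
    Set ((logShellsDH X logv).Packet j vQ))
  (archSub : ∀ (j : (thetaIndex X).Label) (v : (thetaIndex X).V),
    Set ((logShellsDH X logv).Packet j ((thetaIndex X).over v)))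
  (Ψ : ℤ → ∀ v : (thetaIndex X).V, v ∈ (thetaIndex X).Vbad →
    Set ((logShellsDH X logv).StarPacket v))
  (act : ℤ → ∀ v : (thetaIndex X).V, v ∈ (thetaIndex X).Vbad →
    (logShellsDH X logv).StarPacket v → Module.End ℚ ((logShellsDH X logv).StarPacket v))
  (Mmod : ℤ → ∀ j : (thetaIndex X).LabelStar, Set ((logShellsDH X logv).GlobalPacket j.1))
  (region : ℤ → ∀ j : (thetaIndex X).LabelStar, FinDivisor M → ∀ vQ : (thetaIndex X).VQ,
    Set ((logShellsDH X logv).Packet j.1 vQ))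

/-- **No single-Haar «Iff» reading at the PRINT-NORMALISED situation** (`situationPrVol`, c312-1's
probability-weighted container — the weights differ from `situationDHVol`, the admissibility does
not): the p413800 `hAdm` binder is unsatisfiable once one rational prime carries two distinct places
of `F`. Twin of `not_singleHaarAdm_situationDHVol` (p450504), normalisation-caveat-free.
[claim: Mochizuki2012, status: disputed] -/
theorem not_singleHaarAdm_situationPrVol (pp : Nat.Primes)
    {v₁ v₂ : (thetaIndex X).Fibre (.inr pp)} (hv : v₁ ≠ v₂) (n : ℤ)
    (W : (thetaIndex X).Label → (thetaIndex X).VQ → Type*)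
    [∀ j vQ, AddCommGroup (W j vQ)] [∀ j vQ, TopologicalSpace (W j vQ)]
    [∀ j vQ, IsTopologicalAddGroup (W j vQ)] [∀ j vQ, MeasurableSpace (W j vQ)]
    [∀ j vQ, BorelSpace (W j vQ)] (Λ : ∀ j vQ, IntegralStructure (W j vQ))
    (e : ∀ j vQ, (logShellsDH X logv).Packet j vQ → W j vQ) :
    ¬ (∀ (j : (thetaIndex X).Label) (vQ : (thetaIndex X).VQ)
        (A : Set ((logShellsDH X logv).Packet j vQ)),
      ((situationPrVol X hlog M archPk archSub Ψ act Mmod region).D n).Adm j vQ A ↔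
        0 < (Λ j vQ).haar (e j vQ '' A) ∧ (Λ j vQ).haar (e j vQ '' A) < ⊤) := by
  classical
  haveI : Fact (pp : ℕ).Prime := ⟨pp.2⟩
  set P : PadicPresentation (logShellsDH X logv) (.inr pp) pp.1 :=
    padicPresentationPr X pp.1 logv (hlog pp)
  have hz : ∀ e' : (thetaIndex X).Caps 0 → (thetaIndex X).Fibre (.inr pp),
      ∃ z : PacketAlgebra pp.1 (P.kk e'),
        z ∉ (normalizedPacket pp.1 (P.kk e') : Set (PacketAlgebra pp.1 (P.kk e'))) :=
    fun e' => exists_notMem_normalizedPacket pp.1 (P.kk e')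
  choose z hz using hz
  set e₁' : (thetaIndex X).Caps 0 → (thetaIndex X).Fibre (.inr pp) := fun _ => v₁ with he₁
  set e₂' : (thetaIndex X).Caps 0 → (thetaIndex X).Fibre (.inr pp) := fun _ => v₂ with he₂
  have hS₁ := (normalizedPacket_diff_vadd_nonempty pp.1 (P.kk e₁') (hz e₁')).1
  have hS₂ := (normalizedPacket_diff_vadd_nonempty pp.1 (P.kk e₂') (hz e₂')).2
  refine SummandPieces.not_singleHaarAdm_of_realizes
    (realizes_situationPrVol X hlog M archPk archSub Ψ act Mmod region n)
    (j := 0) (vQ := .inr pp) (e₁ := e₁') (e₂ := e₂')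
    (R₁ := fun e' => (normalizedPacket pp.1 (P.kk e') : Set (PacketAlgebra pp.1 (P.kk e'))))
    (R₂ := fun e' => z e' +ᵥ
      (normalizedPacket pp.1 (P.kk e') : Set (PacketAlgebra pp.1 (P.kk e'))))
    ?_ ?_ ?_ hS₁ hS₂ W Λ e
  · intro h
    have h0 := congrFun h (⟨0, Nat.succ_pos _⟩ : (thetaIndex X).Caps 0)
    rw [he₁, he₂] at h0
    exact hv h0
  · intro e'
    exact packetAdm_normalizedPacket pp.1 (P.kk e')
  · intro e'
    exact packetAdm_vadd pp.1 (P.kk e') (z e') (packetAdm_normalizedPacket pp.1 (P.kk e'))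

variable (hc : ∀ w : InfinitePlace F, w.IsComplex)

/-- **No single-Haar «Iff» reading at the HONEST-ARCHIMEDEAN situation** (`situationDHVolArch`,
w5-d163's fourth-corner apparatus, all-complex convention; the `∞`-pieces differ from
`situationDHVol`, the prime-side admissibility does not): the p413800 `hAdm` binder is unsatisfiable
once one rational prime carries two distinct places of `F` — the obstruction lives at a prime and is
untouched by the archimedean convention. [claim: Mochizuki2012, status: disputed] -/
theorem not_singleHaarAdm_situationDHVolArch (pp : Nat.Primes)
    {v₁ v₂ : (thetaIndex X).Fibre (.inr pp)} (hv : v₁ ≠ v₂) (n : ℤ)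
    (W : (thetaIndex X).Label → (thetaIndex X).VQ → Type*)
    [∀ j vQ, AddCommGroup (W j vQ)] [∀ j vQ, TopologicalSpace (W j vQ)]
    [∀ j vQ, IsTopologicalAddGroup (W j vQ)] [∀ j vQ, MeasurableSpace (W j vQ)]
    [∀ j vQ, BorelSpace (W j vQ)] (Λ : ∀ j vQ, IntegralStructure (W j vQ))
    (e : ∀ j vQ, (logShellsDH X logv).Packet j vQ → W j vQ) :
    ¬ (∀ (j : (thetaIndex X).Label) (vQ : (thetaIndex X).VQ)
        (A : Set ((logShellsDH X logv).Packet j vQ)),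
      ((situationDHVolArch X hlog hc M archPk archSub Ψ act Mmod region).D n).Adm j vQ A ↔
        0 < (Λ j vQ).haar (e j vQ '' A) ∧ (Λ j vQ).haar (e j vQ '' A) < ⊤) := by
  classical
  haveI : Fact (pp : ℕ).Prime := ⟨pp.2⟩
  set P : PadicPresentation (logShellsDH X logv) (.inr pp) pp.1 :=
    padicPresentationDH X pp.1 logv (hlog pp)
  have hz : ∀ e' : (thetaIndex X).Caps 0 → (thetaIndex X).Fibre (.inr pp),
      ∃ z : PacketAlgebra pp.1 (P.kk e'),
        z ∉ (normalizedPacket pp.1 (P.kk e') : Set (PacketAlgebra pp.1 (P.kk e'))) :=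
    fun e' => exists_notMem_normalizedPacket pp.1 (P.kk e')
  choose z hz using hz
  set e₁' : (thetaIndex X).Caps 0 → (thetaIndex X).Fibre (.inr pp) := fun _ => v₁ with he₁
  set e₂' : (thetaIndex X).Caps 0 → (thetaIndex X).Fibre (.inr pp) := fun _ => v₂ with he₂
  have hS₁ := (normalizedPacket_diff_vadd_nonempty pp.1 (P.kk e₁') (hz e₁')).1
  have hS₂ := (normalizedPacket_diff_vadd_nonempty pp.1 (P.kk e₂') (hz e₂')).2
  refine SummandPieces.not_singleHaarAdm_of_realizes
    (realizes_situationDHVolArch X hlog hc M archPk archSub Ψ act Mmod region n)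
    (j := 0) (vQ := .inr pp) (e₁ := e₁') (e₂ := e₂')
    (R₁ := fun e' => (normalizedPacket pp.1 (P.kk e') : Set (PacketAlgebra pp.1 (P.kk e'))))
    (R₂ := fun e' => z e' +ᵥ
      (normalizedPacket pp.1 (P.kk e') : Set (PacketAlgebra pp.1 (P.kk e'))))
    ?_ ?_ ?_ hS₁ hS₂ W Λ e
  · intro h
    have h0 := congrFun h (⟨0, Nat.succ_pos _⟩ : (thetaIndex X).Caps 0)
    rw [he₁, he₂] at h0
    exact hv h0
  · intro e'
    exact packetAdm_normalizedPacket pp.1 (P.kk e')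
  · intro e'
    exact packetAdm_vadd pp.1 (P.kk e') (z e') (packetAdm_normalizedPacket pp.1 (P.kk e'))

/-- **No single-Haar «Iff» reading at the situation print-normalised at EVERY place**
(`situationDHVolPrArch`, under the fourth corner `settingPrVolArch`): the p413800 `hAdm` binder is
unsatisfiable once one rational prime carries two distinct places of `F`. With p450504 and the two
twins above, the negative closure of the kit-l. 43 TEAM B residual holds at ALL FOUR normalisation
corners of the real model. [claim: Mochizuki2012, status: disputed] -/
theorem not_singleHaarAdm_situationDHVolPrArch (pp : Nat.Primes)
    {v₁ v₂ : (thetaIndex X).Fibre (.inr pp)} (hv : v₁ ≠ v₂) (n : ℤ)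
    (W : (thetaIndex X).Label → (thetaIndex X).VQ → Type*)
    [∀ j vQ, AddCommGroup (W j vQ)] [∀ j vQ, TopologicalSpace (W j vQ)]
    [∀ j vQ, IsTopologicalAddGroup (W j vQ)] [∀ j vQ, MeasurableSpace (W j vQ)]
    [∀ j vQ, BorelSpace (W j vQ)] (Λ : ∀ j vQ, IntegralStructure (W j vQ))
    (e : ∀ j vQ, (logShellsDH X logv).Packet j vQ → W j vQ) :
    ¬ (∀ (j : (thetaIndex X).Label) (vQ : (thetaIndex X).VQ)
        (A : Set ((logShellsDH X logv).Packet j vQ)),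
      ((situationDHVolPrArch X hlog hc M archPk archSub Ψ act Mmod region).D n).Adm j vQ A ↔
        0 < (Λ j vQ).haar (e j vQ '' A) ∧ (Λ j vQ).haar (e j vQ '' A) < ⊤) := by
  classical
  haveI : Fact (pp : ℕ).Prime := ⟨pp.2⟩
  set P : PadicPresentation (logShellsDH X logv) (.inr pp) pp.1 :=
    padicPresentationPr X pp.1 logv (hlog pp)
  have hz : ∀ e' : (thetaIndex X).Caps 0 → (thetaIndex X).Fibre (.inr pp),
      ∃ z : PacketAlgebra pp.1 (P.kk e'),
        z ∉ (normalizedPacket pp.1 (P.kk e') : Set (PacketAlgebra pp.1 (P.kk e'))) :=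
    fun e' => exists_notMem_normalizedPacket pp.1 (P.kk e')
  choose z hz using hz
  set e₁' : (thetaIndex X).Caps 0 → (thetaIndex X).Fibre (.inr pp) := fun _ => v₁ with he₁
  set e₂' : (thetaIndex X).Caps 0 → (thetaIndex X).Fibre (.inr pp) := fun _ => v₂ with he₂
  have hS₁ := (normalizedPacket_diff_vadd_nonempty pp.1 (P.kk e₁') (hz e₁')).1
  have hS₂ := (normalizedPacket_diff_vadd_nonempty pp.1 (P.kk e₂') (hz e₂')).2
  refine SummandPieces.not_singleHaarAdm_of_realizes
    (realizes_situationDHVolPrArch X hlog hc M archPk archSub Ψ act Mmod region n)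
    (j := 0) (vQ := .inr pp) (e₁ := e₁') (e₂ := e₂')
    (R₁ := fun e' => (normalizedPacket pp.1 (P.kk e') : Set (PacketAlgebra pp.1 (P.kk e'))))
    (R₂ := fun e' => z e' +ᵥ
      (normalizedPacket pp.1 (P.kk e') : Set (PacketAlgebra pp.1 (P.kk e'))))
    ?_ ?_ ?_ hS₁ hS₂ W Λ e
  · intro h
    have h0 := congrFun h (⟨0, Nat.succ_pos _⟩ : (thetaIndex X).Caps 0)
    rw [he₁, he₂] at h0
    exact hv h0
  · intro e'
    exact packetAdm_normalizedPacket pp.1 (P.kk e')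
  · intro e'
    exact packetAdm_vadd pp.1 (P.kk e') (z e') (packetAdm_normalizedPacket pp.1 (P.kk e'))

end Real

end Thm311

end IUTFork

end Summit.ABC

end
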